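import Summits.QuantumFields.YangMills.Theorems.ColdStartUniversalityShenZhuZhuW2DiracContractionSU2
import Summits.QuantumFields.YangMills.Theorems.ColdStartUniversalityLatticeLangevinWeightedLocalGradientBound
import HarnessLib

/-!
# THE WEIGHTED `W₂` CONTRACTION of the `SU(2)` lattice Langevin dynamics on `(ℤ/L)³`:
# `W₂^(d_w)(δ_Q P_t, δ_(Q') P_t) ≤ e^(−κ_b t)·d_w(Q,Q')`, `d_w(Q,Q')² = Σ_e w_e ρ(Q_e,Q'_e)²`, `κ_b = 1 − (4 + 6(b²+1)/b)|β'|`,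
# for every positive link weight `w` with `w_e ≤ b²·w_(e')` on common plaquettes — the torus form of Shen–Zhu–Zhu's weighted coupling (Lemma 5.1 of
# the CMP 2023 paper, metric `ρ_(∞,a)`), by Kuwada's duality from the weighted Bakry–Émery gradient bound

Seat `ym-line-csu-p1` (g43), route `ColdStartUniversality` of `Summits/QuantumFields/YangMills`, helper file (`--supports stmt-QuantumFields-24809`).
The abstract duality is the tree's `kuwada_duality_pairs` (G64b); its inputs here are the WEIGHTED `(G₂)` bound `wilson_wlocal_gradient_bound`
(`…WeightedLocalGradientBound`), the strong Feller bound (G61, transported to `d_w ≥ √m·ρ_L`), the constant-speed product geodesics (which are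
geodesics for every `d_w`), and Kantorovich duality for the continuous cost `d_w²`.
* `continuous_wdistSq`, `wdistSq_comm`, `wdistSq_eq_zero_iff`, `isOpen_iff_wdist_ball` — `d_w` metrises the topology of `SU(2)^E`;
* ★ `exists_constSpeed_wgeodesic_two` — `d_w(γ_s, γ_(s')) = |s − s'|·d_w(Q,Q')` along the product flow of minimal logarithms;
* ★★★ `wilson_wkuwada_pairs` — `t > 0`: `∫φ dκ_t(x) + ∫ψ dκ_t(y) ≤ e^(−2κ_b t)·d_w(x,y)²` for all continuous `φ ⊕ ψ ≤ d_w²`;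
* ★★★★ `wilson_szzWasserstein_wW2_contraction` — `t > 0`: `szzWassersteinSq d_w² (κ_t(Q,·)) (κ_t(Q',·)) ≤ ofReal(e^(−2κ_b t)·d_w(Q,Q')²)`;
* ★★★★ **`szzDiracContraction_wW2_su2`** — `SZZDiracContraction (fundamentalLatticeRep 2) 3 L β' κ_b d_w²` for every `L`, `|β'| < 1/12`, every such `w`.
THEOREMS ONLY, no definition (the metric structure `d_w` is a `letI` inside the proofs), no sorry.  HONEST FRAMING: fixed cut-off, finite volume, high
temperature; nothing `K`-uniform along the route's scaling; `UniformColdStartMixing` (24809, ASIDE) is not restated; no crux, rung or summit statement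
is proved; the Yang–Mills mass gap is NOT proved.
-/

set_option autoImplicit false

noncomputable section

namespace Summit.QuantumFields.YangMills.Theorems.ColdStartUniversality

open MeasureTheory ProbabilityTheory Matrix Complex Finset Filter Topology Set Metric
open scoped BigOperators NNReal ENNReal
open Literature.MathematicalPhysics.QuantumFieldTheory
open Literature.MathematicalPhysics.QuantumLattice (fundamentalRep fundamentalLatticeRep continuous_fundamentalRep fundamentalRep_apply fundamentalLatticeRep_N)

variable {L : ℕ} [NeZero L]

/-! ## §1. `d_w` metrises `SU(2)^E`; weighted geodesics -/

/-- `(U,U') ↦ d_w(U,U')²` is continuous. [folklore] -/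
theorem continuous_wdistSq (w : Edge 3 L → ℝ) :
    Continuous fun p : GaugeConfig 3 L (Matrix.specialUnitaryGroup (Fin 2) ℂ) × GaugeConfig 3 L (Matrix.specialUnitaryGroup (Fin 2) ℂ) => (∑ e : Edge 3 L, w e * (fundamentalLatticeRep 2).riemannDist (p.1 e) (p.2 e) ^ 2) := by
  refine continuous_finsetSum _ fun e _ => continuous_const.mul ?_
  have he : Continuous fun p : GaugeConfig 3 L (Matrix.specialUnitaryGroup (Fin 2) ℂ) × GaugeConfig 3 L (Matrix.specialUnitaryGroup (Fin 2) ℂ) => ((p.1 e, p.2 e) : Matrix.specialUnitaryGroup (Fin 2) ℂ × Matrix.specialUnitaryGroup (Fin 2) ℂ) :=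
    ((continuous_apply e).comp continuous_fst).prodMk ((continuous_apply e).comp continuous_snd)
  exact (continuous_riemannDist_two.comp he).pow 2

/-- `d_w` is symmetric. [folklore] -/
theorem wdistSq_comm (U U' : GaugeConfig 3 L (Matrix.specialUnitaryGroup (Fin 2) ℂ)) (w : Edge 3 L → ℝ) : (∑ e : Edge 3 L, w e * (fundamentalLatticeRep 2).riemannDist (U e) (U' e) ^ 2) = (∑ e : Edge 3 L, w e * (fundamentalLatticeRep 2).riemannDist (U' e) (U e) ^ 2) :=
  Finset.sum_congr rfl fun e _ => by rw [riemannDist_two_comm]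

/-- `d_w(U,U') = 0 ↔ U = U'` for a positive weight. [folklore] -/
theorem wdistSq_eq_zero_iff (U U' : GaugeConfig 3 L (Matrix.specialUnitaryGroup (Fin 2) ℂ)) (w : Edge 3 L → ℝ) (hw : ∀ e, 0 < w e) : (∑ e : Edge 3 L, w e * (fundamentalLatticeRep 2).riemannDist (U e) (U' e) ^ 2) = 0 ↔ U = U' := by
  rw [Finset.sum_eq_zero_iff_of_nonneg (fun e _ => mul_nonneg (hw e).le (sq_nonneg _))]
  constructor
  · intro h; funext e
    have he := h e (Finset.mem_univ e)
    rw [mul_eq_zero, sq_eq_zero_iff, riemannDist_two_eq_zero_iff] at he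
    exact he.resolve_left (hw e).ne'
  · intro h e _
    rw [h, (fundamentalLatticeRep 2).riemannDist_self, sq, mul_zero, mul_zero]

/-- `d_w` (`0 < m ≤ w ≤ M`) generates the topology of `SU(2)^E` (it is comparable to `ρ_L`, G58). [folklore] -/
theorem isOpen_iff_wdist_ball (w : Edge 3 L → ℝ) {m M : ℝ} (hm : 0 < m) (hwm : ∀ e, m ≤ w e) (hwM : ∀ e, w e ≤ M) (s : Set (GaugeConfig 3 L (Matrix.specialUnitaryGroup (Fin 2) ℂ))) :
    IsOpen s ↔ ∀ x ∈ s, ∃ ε > 0, ∀ y : GaugeConfig 3 L (Matrix.specialUnitaryGroup (Fin 2) ℂ), Real.sqrt (∑ e : Edge 3 L, w e * (fundamentalLatticeRep 2).riemannDist (x e) (y e) ^ 2) < ε → y ∈ s := by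
  rw [isOpen_iff_riemannDist_ball]
  have hnn : ∀ x y : GaugeConfig 3 L (Matrix.specialUnitaryGroup (Fin 2) ℂ), 0 ≤ torusRiemannDistSq (fundamentalLatticeRep 2) x y := fun x y => by
    unfold torusRiemannDistSq; exact Finset.sum_nonneg fun _ _ => sq_nonneg _
  constructor
  · intro h x hx
    obtain ⟨ε, hε, hb⟩ := h x hx
    refine ⟨Real.sqrt m * ε, by positivity, fun y hy => hb y ?_⟩
    have h1 : Real.sqrt m * Real.sqrt (torusRiemannDistSq (fundamentalLatticeRep 2) (x) (y)) ≤ Real.sqrt (∑ e : Edge 3 L, w e * (fundamentalLatticeRep 2).riemannDist (x e) (y e) ^ 2) := by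
      rw [← Real.sqrt_mul hm.le]; exact Real.sqrt_le_sqrt (mul_le_wdistSq x y w hwm)
    exact lt_of_mul_lt_mul_left (h1.trans_lt hy) (Real.sqrt_nonneg m)
  · intro h x hx
    obtain ⟨ε, hε, hb⟩ := h x hx
    have hM1 : 0 < Real.sqrt M + 1 := by positivity
    refine ⟨ε / (Real.sqrt M + 1), div_pos hε hM1, fun y hy => hb y ?_⟩
    have h1 : Real.sqrt (∑ e : Edge 3 L, w e * (fundamentalLatticeRep 2).riemannDist (x e) (y e) ^ 2) ≤ Real.sqrt M * Real.sqrt (torusRiemannDistSq (fundamentalLatticeRep 2) (x) (y)) := wdist_le_sqrt_mul x y w hwM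
    have h2 : Real.sqrt M * Real.sqrt (torusRiemannDistSq (fundamentalLatticeRep 2) (x) (y)) ≤ (Real.sqrt M + 1) * Real.sqrt (torusRiemannDistSq (fundamentalLatticeRep 2) (x) (y)) :=
      mul_le_mul_of_nonneg_right (by linarith) (Real.sqrt_nonneg _)
    have h3 : (Real.sqrt M + 1) * Real.sqrt (torusRiemannDistSq (fundamentalLatticeRep 2) (x) (y)) < (Real.sqrt M + 1) * (ε / (Real.sqrt M + 1)) := mul_lt_mul_of_pos_left hy hM1
    rw [mul_div_cancel₀ _ hM1.ne'] at h3
    linarith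

/-- ★ **Weighted geodesic interpolation**: for all `Q, Q'` and every weight `w ≥ 0` there is a path `γ` with `γ 0 = Q`, `γ 1 = Q'` and
`d_w(γ_s, γ_(s')) = |s − s'|·d_w(Q,Q')` on `[0,1]` (the product flow of the minimal logarithms moves each link along its own geodesic).
[cite: GallotHulinLafontaine2004, 2.91] -/
theorem exists_constSpeed_wgeodesic_two (Q Q' : GaugeConfig 3 L (Matrix.specialUnitaryGroup (Fin 2) ℂ)) (w : Edge 3 L → ℝ) :
    ∃ γ : ℝ → GaugeConfig 3 L (Matrix.specialUnitaryGroup (Fin 2) ℂ), γ 0 = Q ∧ γ 1 = Q' ∧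
      ∀ s ∈ Set.Icc (0 : ℝ) 1, ∀ s' ∈ Set.Icc (0 : ℝ) 1, Real.sqrt (∑ e : Edge 3 L, w e * (fundamentalLatticeRep 2).riemannDist (γ s e) (γ s' e) ^ 2) = |s - s'| * Real.sqrt (∑ e : Edge 3 L, w e * (fundamentalLatticeRep 2).riemannDist (Q e) (Q' e) ^ 2) := by
  classical
  have hlog : ∀ e : Edge 3 L, ∃ X : Matrix (Fin 2) (Fin 2) ℂ, X ∈ (fundamentalLatticeRep 2).lieAlg ∧
      NormedSpace.exp X * (Q e : Matrix (Fin 2) (Fin 2) ℂ) = (Q' e : Matrix (Fin 2) (Fin 2) ℂ) ∧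
      Real.sqrt (hsForm 2 X X) = (fundamentalLatticeRep 2).riemannDist (Q e) (Q' e) := fun e =>
    exists_mem_lieAlg_exp_mul_eq_sqrt_hsForm_eq_riemannDist (Q e) (Q' e)
  choose X hXmem hXexp hXnorm using hlog
  have hXh : ∀ e, (X e)ᴴ = -(X e) := fun e => by
    rw [← Matrix.star_eq_conjTranspose]; exact (fundamentalLatticeRep 2).star_eq_neg_of_mem_lieAlg (hXmem e)
  have hX0 : ∀ e, (X e).trace = 0 := fun e => trace_eq_zero_of_mem_lieAlg_two (hXmem e)
  have hXle : ∀ e, Real.sqrt (hsForm 2 (X e) (X e)) ≤ Real.sqrt 2 * Real.pi := fun e => by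
    rw [hXnorm e]; exact riemannDist_two_le _ _
  refine ⟨fun s e => SUNBakryEmery.expSU (N := 2) (Y := Matrix.of fun i j : Fin 2 => X e i j) (hXh e) (hX0 e) s * Q e, ?_, ?_, fun s hs s' hs' => ?_⟩
  · funext e; apply Subtype.ext
    change NormedSpace.exp ((0 : ℝ) • X e) * (Q e : Matrix (Fin 2) (Fin 2) ℂ) = (Q e : Matrix (Fin 2) (Fin 2) ℂ)
    rw [zero_smul, NormedSpace.exp_zero, Matrix.one_mul]
  · funext e; apply Subtype.ext
    change NormedSpace.exp ((1 : ℝ) • X e) * (Q e : Matrix (Fin 2) (Fin 2) ℂ) = (Q' e : Matrix (Fin 2) (Fin 2) ℂ)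
    rw [one_smul, hXexp e]
  · have hss : |s - s'| ≤ 1 := by rw [abs_le]; constructor <;> linarith [hs.1, hs.2, hs'.1, hs'.2]
    have hterm : ∀ e : Edge 3 L, w e * (fundamentalLatticeRep 2).riemannDist
        (SUNBakryEmery.expSU (N := 2) (Y := Matrix.of fun i j : Fin 2 => X e i j) (hXh e) (hX0 e) s * Q e)
        (SUNBakryEmery.expSU (N := 2) (Y := Matrix.of fun i j : Fin 2 => X e i j) (hXh e) (hX0 e) s' * Q e) ^ 2 =
        (s - s') ^ 2 * (w e * (fundamentalLatticeRep 2).riemannDist (Q e) (Q' e) ^ 2) := by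
      intro e
      have hle : |s - s'| * Real.sqrt (hsForm 2 (X e) (X e)) ≤ Real.sqrt 2 * Real.pi :=
        le_trans (mul_le_of_le_one_left (Real.sqrt_nonneg _) hss) (hXle e)
      rw [riemannDist_expSU_mul_two (hXmem e) (hXh e) (hX0 e) (Q e) hle, hXnorm e, mul_pow, sq_abs]; ring
    show Real.sqrt (∑ e : Edge 3 L, w e * (fundamentalLatticeRep 2).riemannDist
        (SUNBakryEmery.expSU (N := 2) (Y := Matrix.of fun i j : Fin 2 => X e i j) (hXh e) (hX0 e) s * Q e)
        (SUNBakryEmery.expSU (N := 2) (Y := Matrix.of fun i j : Fin 2 => X e i j) (hXh e) (hX0 e) s' * Q e) ^ 2) = _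
    simp_rw [hterm]
    rw [← Finset.mul_sum, Real.sqrt_mul (sq_nonneg _), Real.sqrt_sq_eq_abs]

/-! ## §2. Kuwada's duality for the weighted distance: the Kantorovich-pair form -/

/-- ★★★ **Kuwada's duality for the SZZ semigroup and the weighted distance, dual form.**  Let `b ≥ 1`, `|β'| < 1/12`, `0 < m ≤ w ≤ M` a link weight with
`w_e ≤ b²·w_(e')` on common plaquettes, `t > 0`, `κ` a realising kernel family, and `φ, ψ` continuous with `φ(u) + ψ(v) ≤ d_w(u,v)²`.  Then
`∫φ dκ_t(x) + ∫ψ dκ_t(y) ≤ e^(−2(1 − (4+6(b²+1)/b)|β'|)t)·d_w(x,y)²`. [cite: BakryGentilLedoux2014, Thm 9.7.2] [cite: ShenZhuZhuCMP2023, Lemma 5.1 / (5.13)] -/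
theorem wilson_wkuwada_pairs (L : ℕ) [NeZero L] (β' b : ℝ) (hb : 1 ≤ b) (hβ : |β'| < 1 / 12) (w : Edge 3 L → ℝ) {m M : ℝ} (hm : 0 < m)
    (hwm : ∀ e, m ≤ w e) (hwM : ∀ e, w e ≤ M)
    (hwb : ∀ (p : Plaquette 3 L) (e e' : Edge 3 L), e ∈ ({(p.1, p.2.1.1), (p.1.shift p.2.1.1, p.2.1.2), (p.1.shift p.2.1.2, p.2.1.1), (p.1, p.2.1.2)} : Finset (Edge 3 L)) → e' ∈ ({(p.1, p.2.1.1), (p.1.shift p.2.1.1, p.2.1.2), (p.1.shift p.2.1.2, p.2.1.1), (p.1, p.2.1.2)} : Finset (Edge 3 L)) → w e ≤ b ^ 2 * w e')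
    (κ : ℝ≥0 → Kernel (GaugeConfig 3 L (Matrix.specialUnitaryGroup (Fin 2) ℂ))
      (GaugeConfig 3 L (Matrix.specialUnitaryGroup (Fin 2) ℂ))) [∀ t, IsMarkovKernel (κ t)]
    (hreal : ∀ (t : ℝ≥0) (x : GaugeConfig 3 L (Matrix.specialUnitaryGroup (Fin 2) ℂ))
        (Ω : Type) [MeasurableSpace Ω] (P : Measure Ω) [IsProbabilityMeasure P]
        (W : ℝ≥0 → Ω → (Edge 3 L × NoiseIdx 2 → ℝ)) (hW : IsFlatBrownian W P)
        (U : ℝ≥0 → Ω → GaugeConfig 3 L (Matrix.specialUnitaryGroup (Fin 2) ℂ)),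
        (∀ ω, U 0 ω = x) →
        (latticeLangevinDynamics (fundamentalLatticeRep 2) β').IsSolution (fundamentalRep (Fin 2))
          hW.natFiltration P W U →
        κ t x = P.map (U t))
    {t : ℝ≥0} (ht : 0 < (t : ℝ)) {φ ψ : GaugeConfig 3 L (Matrix.specialUnitaryGroup (Fin 2) ℂ) → ℝ} (hφ : Continuous φ) (hψ : Continuous ψ)
    (h : ∀ u v, φ u + ψ v ≤ (∑ e : Edge 3 L, w e * (fundamentalLatticeRep 2).riemannDist (u e) (v e) ^ 2)) (x y : GaugeConfig 3 L (Matrix.specialUnitaryGroup (Fin 2) ℂ)) :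
    ∫ z, φ z ∂(κ t x) + ∫ z, ψ z ∂(κ t y) ≤ Real.exp (-(2 * (1 - (4 + 6 * ((b ^ 2 + 1) / b)) * |β'|) * (t : ℝ))) * (∑ e : Edge 3 L, w e * (fundamentalLatticeRep 2).riemannDist (x e) (y e) ^ 2) := by
  classical
  haveI := secondCountableTopology_su2
  haveI := borelSpace_config L
  have hw : ∀ e, 0 < w e := fun e => hm.trans_le (hwm e)
  have hnn : ∀ u v : GaugeConfig 3 L (Matrix.specialUnitaryGroup (Fin 2) ℂ), 0 ≤ (∑ e : Edge 3 L, w e * (fundamentalLatticeRep 2).riemannDist (u e) (v e) ^ 2) := fun u v => Finset.sum_nonneg fun e _ => mul_nonneg (hw e).le (sq_nonneg _)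
  have hρnn : ∀ u v : GaugeConfig 3 L (Matrix.specialUnitaryGroup (Fin 2) ℂ), 0 ≤ torusRiemannDistSq (fundamentalLatticeRep 2) u v := fun u v => by
    unfold torusRiemannDistSq; exact Finset.sum_nonneg fun _ _ => sq_nonneg _
  have hzero : ∀ u v : GaugeConfig 3 L (Matrix.specialUnitaryGroup (Fin 2) ℂ), Real.sqrt (∑ e : Edge 3 L, w e * (fundamentalLatticeRep 2).riemannDist (u e) (v e) ^ 2) = 0 ↔ u = v := fun u v => by
    rw [Real.sqrt_eq_zero (hnn u v), wdistSq_eq_zero_iff u v w hw]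
  have hself : ∀ u : GaugeConfig 3 L (Matrix.specialUnitaryGroup (Fin 2) ℂ), Real.sqrt (∑ e : Edge 3 L, w e * (fundamentalLatticeRep 2).riemannDist (u e) (u e) ^ 2) = 0 := fun u => (hzero u u).2 rfl
  have hcomm : ∀ u v : GaugeConfig 3 L (Matrix.specialUnitaryGroup (Fin 2) ℂ), Real.sqrt (∑ e : Edge 3 L, w e * (fundamentalLatticeRep 2).riemannDist (u e) (v e) ^ 2) = Real.sqrt (∑ e : Edge 3 L, w e * (fundamentalLatticeRep 2).riemannDist (v e) (u e) ^ 2) := fun u v => by rw [wdistSq_comm u v w]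
  have htri : ∀ u v z : GaugeConfig 3 L (Matrix.specialUnitaryGroup (Fin 2) ℂ), Real.sqrt (∑ e : Edge 3 L, w e * (fundamentalLatticeRep 2).riemannDist (u e) (z e) ^ 2) ≤ Real.sqrt (∑ e : Edge 3 L, w e * (fundamentalLatticeRep 2).riemannDist (u e) (v e) ^ 2) + Real.sqrt (∑ e : Edge 3 L, w e * (fundamentalLatticeRep 2).riemannDist (v e) (z e) ^ 2) :=
    fun u v z => wdist_triangle u v z w fun e => (hw e).le
  letI : MetricSpace (GaugeConfig 3 L (Matrix.specialUnitaryGroup (Fin 2) ℂ)) :=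
    { __ := PseudoMetricSpace.ofDistTopology (fun u v : GaugeConfig 3 L (Matrix.specialUnitaryGroup (Fin 2) ℂ) => Real.sqrt (∑ e : Edge 3 L, w e * (fundamentalLatticeRep 2).riemannDist (u e) (v e) ^ 2)) hself hcomm htri (isOpen_iff_wdist_ball w hm hwm hwM),
      eq_of_dist_eq_zero := fun {u v} huv => (hzero u v).1 huv }
  have hdist : ∀ u v : GaugeConfig 3 L (Matrix.specialUnitaryGroup (Fin 2) ℂ), dist u v = Real.sqrt (∑ e : Edge 3 L, w e * (fundamentalLatticeRep 2).riemannDist (u e) (v e) ^ 2) := fun u v => rfl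
  have hsm : 0 < Real.sqrt m := Real.sqrt_pos.2 hm
  have hρle : ∀ u v : GaugeConfig 3 L (Matrix.specialUnitaryGroup (Fin 2) ℂ), Real.sqrt (torusRiemannDistSq (fundamentalLatticeRep 2) (u) (v)) ≤ dist u v / Real.sqrt m := fun u v => by
    rw [hdist, le_div_iff₀ hsm, mul_comm, ← Real.sqrt_mul hm.le]
    exact Real.sqrt_le_sqrt (mul_le_wdistSq u v w hwm)
  have hdle : ∀ u v : GaugeConfig 3 L (Matrix.specialUnitaryGroup (Fin 2) ℂ), dist u v ≤ Real.sqrt M * Real.sqrt (torusRiemannDistSq (fundamentalLatticeRep 2) (u) (v)) := fun u v => wdist_le_sqrt_mul u v w hwM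
  -- the three hypotheses of the abstract duality
  have ha : 0 ≤ Real.exp (-((1 - (4 + 6 * ((b ^ 2 + 1) / b)) * |β'|) * (t : ℝ))) := (Real.exp_pos _).le
  have hb0 : 0 ≤ Real.sqrt ((1 - 12 * |β'|) / (Real.exp (2 * (1 - 12 * |β'|) * (t : ℝ)) - 1)) / Real.sqrt m := div_nonneg (Real.sqrt_nonneg _) hsm.le
  have hSF : ∀ (G : GaugeConfig 3 L (Matrix.specialUnitaryGroup (Fin 2) ℂ) → ℝ) (MG : ℝ), UpperSemicontinuous G → (∀ z, 0 ≤ G z) → (∀ z, G z ≤ MG) →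
      ∀ u u' : GaugeConfig 3 L (Matrix.specialUnitaryGroup (Fin 2) ℂ), |∫ z, G z ∂(κ t u') - ∫ z, G z ∂(κ t u)| ≤
        Real.sqrt ((1 - 12 * |β'|) / (Real.exp (2 * (1 - 12 * |β'|) * (t : ℝ)) - 1)) / Real.sqrt m * MG * dist u u' := by
    intro G MG hG h0 hM u u'
    have h1 := wilson_strongFeller_upperSemicontinuous L β' hβ κ hreal hG h0 hM ht u u'
    have hMG : 0 ≤ MG := (h0 u).trans (hM u)
    have hC : 0 ≤ Real.sqrt ((1 - 12 * |β'|) / (Real.exp (2 * (1 - 12 * |β'|) * (t : ℝ)) - 1)) * MG := mul_nonneg (Real.sqrt_nonneg _) hMG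
    calc |∫ z, G z ∂(κ t u') - ∫ z, G z ∂(κ t u)|
        ≤ Real.sqrt ((1 - 12 * |β'|) / (Real.exp (2 * (1 - 12 * |β'|) * (t : ℝ)) - 1)) * MG * Real.sqrt (torusRiemannDistSq (fundamentalLatticeRep 2) (u) (u')) := h1
      _ ≤ Real.sqrt ((1 - 12 * |β'|) / (Real.exp (2 * (1 - 12 * |β'|) * (t : ℝ)) - 1)) * MG * (dist u u' / Real.sqrt m) :=
          mul_le_mul_of_nonneg_left (hρle u u') hC
      _ = Real.sqrt ((1 - 12 * |β'|) / (Real.exp (2 * (1 - 12 * |β'|) * (t : ℝ)) - 1)) / Real.sqrt m * MG * dist u u' := by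
          field_simp
  have hG2 : ∀ (F : GaugeConfig 3 L (Matrix.specialUnitaryGroup (Fin 2) ℂ) → ℝ) (Lf : ℝ), 0 ≤ Lf → (∀ z z' : GaugeConfig 3 L (Matrix.specialUnitaryGroup (Fin 2) ℂ), |F z' - F z| ≤ Lf * dist z z') → ∀ (R : ℝ), 0 < R →
      ∀ (G : GaugeConfig 3 L (Matrix.specialUnitaryGroup (Fin 2) ℂ) → ℝ) (MG : ℝ), Measurable G → (∀ z, 0 ≤ G z) → (∀ z, G z ≤ MG) →
      (∀ z z' z'' : GaugeConfig 3 L (Matrix.specialUnitaryGroup (Fin 2) ℂ), dist z z' ≤ R → dist z z'' ≤ R → |F z'' - F z'| ≤ G z * dist z' z'') →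
      ∀ (u u' : GaugeConfig 3 L (Matrix.specialUnitaryGroup (Fin 2) ℂ)) (S : ℝ), (∀ z : GaugeConfig 3 L (Matrix.specialUnitaryGroup (Fin 2) ℂ), dist u z ≤ dist u u' → ∫ y, G y ^ 2 ∂(κ t z) ≤ S) →
        |∫ y, F y ∂(κ t u') - ∫ y, F y ∂(κ t u)| ≤ Real.exp (-((1 - (4 + 6 * ((b ^ 2 + 1) / b)) * |β'|) * (t : ℝ))) * Real.sqrt S * dist u u' := by
    intro F Lf hLf hlipF R hR G MG hGm hG0 hGM hloc u u' S hS
    have hlipρ : ∀ Q Q' : GaugeConfig 3 L (Matrix.specialUnitaryGroup (Fin 2) ℂ), |F Q' - F Q| ≤ Lf * Real.sqrt M * Real.sqrt (torusRiemannDistSq (fundamentalLatticeRep 2) (Q) (Q')) := fun Q Q' =>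
      (hlipF Q Q').trans (by rw [mul_assoc]; exact mul_le_mul_of_nonneg_left (hdle Q Q') hLf)
    exact wilson_wlocal_gradient_bound L β' b hb w hm hwm hwM hwb κ hreal (by positivity) hlipρ hR hGm hG0 hGM hloc t u u' hS
  have hgeo : ∀ u v : GaugeConfig 3 L (Matrix.specialUnitaryGroup (Fin 2) ℂ), ∃ γ : ℝ → GaugeConfig 3 L (Matrix.specialUnitaryGroup (Fin 2) ℂ), γ 0 = v ∧ γ 1 = u ∧
      ∀ s s' : ℝ, s ∈ Set.Icc (0 : ℝ) 1 → s' ∈ Set.Icc (0 : ℝ) 1 → dist (γ s) (γ s') ≤ |s - s'| * dist u v := by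
    intro u v
    obtain ⟨γ, h0, h1, hd⟩ := exists_constSpeed_wgeodesic_two v u w
    refine ⟨γ, h0, h1, fun s s' hs hs' => ?_⟩
    rw [hdist, hdist, hd s hs s' hs', ← hdist, ← hdist, dist_comm v u]
  have h' : ∀ u v : GaugeConfig 3 L (Matrix.specialUnitaryGroup (Fin 2) ℂ), φ u + ψ v ≤ dist u v ^ 2 := fun u v => by
    rw [hdist, Real.sq_sqrt (hnn u v)]; exact h u v
  have hmain := kuwada_duality_pairs (κ t) ha hb0 hSF hG2 hgeo hφ hψ h' x y
  have hd2 : dist x y ^ 2 = (∑ e : Edge 3 L, w e * (fundamentalLatticeRep 2).riemannDist (x e) (y e) ^ 2) := by rw [hdist, Real.sq_sqrt (hnn x y)]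
  have he : Real.exp (-((1 - (4 + 6 * ((b ^ 2 + 1) / b)) * |β'|) * (t : ℝ))) ^ 2 = Real.exp (-(2 * (1 - (4 + 6 * ((b ^ 2 + 1) / b)) * |β'|) * (t : ℝ))) := by
    rw [← Real.exp_nat_mul]; congr 1; push_cast; ring
  rw [hd2, he] at hmain
  exact hmain

/-! ## §3. The optimal coupling -/

/-- ★★★★ **The weighted `W₂` contraction with an optimal coupling, at every time `t > 0`.**  Under the hypotheses of `wilson_wkuwada_pairs`:
`szzWassersteinSq d_w² (κ_t(Q,·)) (κ_t(Q',·)) ≤ ofReal(e^(−2κ_b t)·d_w(Q,Q')²)`, `κ_b = 1 − (4+6(b²+1)/b)|β'|` — Kantorovich duality (tree) for the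
continuous cost `d_w²` applied to §2. [cite: ShenZhuZhuCMP2023, Lemma 5.1 / (5.13)] [cite: Villani2003, Thm. 1.3] -/
theorem wilson_szzWasserstein_wW2_contraction (L : ℕ) [NeZero L] (Q Q' : GaugeConfig 3 L (Matrix.specialUnitaryGroup (Fin 2) ℂ)) (β' b : ℝ) (hb : 1 ≤ b) (hβ : |β'| < 1 / 12)
    (w : Edge 3 L → ℝ) {m M : ℝ} (hm : 0 < m) (hwm : ∀ e, m ≤ w e) (hwM : ∀ e, w e ≤ M)
    (hwb : ∀ (p : Plaquette 3 L) (e e' : Edge 3 L), e ∈ ({(p.1, p.2.1.1), (p.1.shift p.2.1.1, p.2.1.2), (p.1.shift p.2.1.2, p.2.1.1), (p.1, p.2.1.2)} : Finset (Edge 3 L)) → e' ∈ ({(p.1, p.2.1.1), (p.1.shift p.2.1.1, p.2.1.2), (p.1.shift p.2.1.2, p.2.1.1), (p.1, p.2.1.2)} : Finset (Edge 3 L)) → w e ≤ b ^ 2 * w e')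
    (κ : ℝ≥0 → Kernel (GaugeConfig 3 L (Matrix.specialUnitaryGroup (Fin 2) ℂ))
      (GaugeConfig 3 L (Matrix.specialUnitaryGroup (Fin 2) ℂ))) [∀ t, IsMarkovKernel (κ t)]
    (hreal : ∀ (t : ℝ≥0) (x : GaugeConfig 3 L (Matrix.specialUnitaryGroup (Fin 2) ℂ))
        (Ω : Type) [MeasurableSpace Ω] (P : Measure Ω) [IsProbabilityMeasure P]
        (W : ℝ≥0 → Ω → (Edge 3 L × NoiseIdx 2 → ℝ)) (hW : IsFlatBrownian W P)
        (U : ℝ≥0 → Ω → GaugeConfig 3 L (Matrix.specialUnitaryGroup (Fin 2) ℂ)),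
        (∀ ω, U 0 ω = x) →
        (latticeLangevinDynamics (fundamentalLatticeRep 2) β').IsSolution (fundamentalRep (Fin 2))
          hW.natFiltration P W U →
        κ t x = P.map (U t))
    {t : ℝ≥0} (ht : 0 < (t : ℝ)) :
    szzWassersteinSq (fun U U' : GaugeConfig 3 L (Matrix.specialUnitaryGroup (Fin 2) ℂ) => (∑ e : Edge 3 L, w e * (fundamentalLatticeRep 2).riemannDist (U e) (U' e) ^ 2)) (κ t Q) (κ t Q') ≤ ENNReal.ofReal (Real.exp (-(2 * (1 - (4 + 6 * ((b ^ 2 + 1) / b)) * |β'|) * (t : ℝ))) * (∑ e : Edge 3 L, w e * (fundamentalLatticeRep 2).riemannDist (Q e) (Q' e) ^ 2)) := by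
  classical
  haveI := secondCountableTopology_su2
  haveI := borelSpace_config L
  have hw : ∀ e, 0 < w e := fun e => hm.trans_le (hwm e)
  have hnn : ∀ u v : GaugeConfig 3 L (Matrix.specialUnitaryGroup (Fin 2) ℂ), 0 ≤ (∑ e : Edge 3 L, w e * (fundamentalLatticeRep 2).riemannDist (u e) (v e) ^ 2) := fun u v => Finset.sum_nonneg fun e _ => mul_nonneg (hw e).le (sq_nonneg _)
  have hcont2 : Continuous fun p : GaugeConfig 3 L (Matrix.specialUnitaryGroup (Fin 2) ℂ) × GaugeConfig 3 L (Matrix.specialUnitaryGroup (Fin 2) ℂ) => (∑ e : Edge 3 L, w e * (fundamentalLatticeRep 2).riemannDist (p.1 e) (p.2 e) ^ 2) := continuous_wdistSq w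
  have hzero : ∀ u v : GaugeConfig 3 L (Matrix.specialUnitaryGroup (Fin 2) ℂ), Real.sqrt (∑ e : Edge 3 L, w e * (fundamentalLatticeRep 2).riemannDist (u e) (v e) ^ 2) = 0 ↔ u = v := fun u v => by
    rw [Real.sqrt_eq_zero (hnn u v), wdistSq_eq_zero_iff u v w hw]
  have hself : ∀ u : GaugeConfig 3 L (Matrix.specialUnitaryGroup (Fin 2) ℂ), Real.sqrt (∑ e : Edge 3 L, w e * (fundamentalLatticeRep 2).riemannDist (u e) (u e) ^ 2) = 0 := fun u => (hzero u u).2 rfl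
  have hcomm : ∀ u v : GaugeConfig 3 L (Matrix.specialUnitaryGroup (Fin 2) ℂ), Real.sqrt (∑ e : Edge 3 L, w e * (fundamentalLatticeRep 2).riemannDist (u e) (v e) ^ 2) = Real.sqrt (∑ e : Edge 3 L, w e * (fundamentalLatticeRep 2).riemannDist (v e) (u e) ^ 2) := fun u v => by rw [wdistSq_comm u v w]
  have htri : ∀ u v z : GaugeConfig 3 L (Matrix.specialUnitaryGroup (Fin 2) ℂ), Real.sqrt (∑ e : Edge 3 L, w e * (fundamentalLatticeRep 2).riemannDist (u e) (z e) ^ 2) ≤ Real.sqrt (∑ e : Edge 3 L, w e * (fundamentalLatticeRep 2).riemannDist (u e) (v e) ^ 2) + Real.sqrt (∑ e : Edge 3 L, w e * (fundamentalLatticeRep 2).riemannDist (v e) (z e) ^ 2) :=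
    fun u v z => wdist_triangle u v z w fun e => (hw e).le
  letI : MetricSpace (GaugeConfig 3 L (Matrix.specialUnitaryGroup (Fin 2) ℂ)) :=
    { __ := PseudoMetricSpace.ofDistTopology (fun u v : GaugeConfig 3 L (Matrix.specialUnitaryGroup (Fin 2) ℂ) => Real.sqrt (∑ e : Edge 3 L, w e * (fundamentalLatticeRep 2).riemannDist (u e) (v e) ^ 2)) hself hcomm htri (isOpen_iff_wdist_ball w hm hwm hwM),
      eq_of_dist_eq_zero := fun {u v} huv => (hzero u v).1 huv }
  -- the cost `c = d_w²` and Kantorovich duality on the compact metric space `(SU(2)^E, d_w)`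
  let c : C(GaugeConfig 3 L (Matrix.specialUnitaryGroup (Fin 2) ℂ) × GaugeConfig 3 L (Matrix.specialUnitaryGroup (Fin 2) ℂ), ℝ) := ⟨fun p => (∑ e : Edge 3 L, w e * (fundamentalLatticeRep 2).riemannDist (p.1 e) (p.2 e) ^ 2), hcont2⟩
  obtain ⟨π, hπ, hlub⟩ := Literature.MeasureTheory.OptimalTransport.exists_isCoupling_isLUB_integral (μ := κ t Q) (ν := κ t Q')
    (by rw [measure_univ, measure_univ]) c
  have hub : Real.exp (-(2 * (1 - (4 + 6 * ((b ^ 2 + 1) / b)) * |β'|) * (t : ℝ))) * (∑ e : Edge 3 L, w e * (fundamentalLatticeRep 2).riemannDist (Q e) (Q' e) ^ 2) ∈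
      upperBounds (Literature.MeasureTheory.OptimalTransport.dualValues (κ t Q) (κ t Q') c) := by
    rintro r ⟨φ, ψ, hφψ, rfl⟩
    exact wilson_wkuwada_pairs L β' b hb hβ w hm hwm hwM hwb κ hreal ht φ.continuous ψ.continuous (fun u v => hφψ u v) Q Q'
  have hcost : ∫ z, c z ∂π ≤ Real.exp (-(2 * (1 - (4 + 6 * ((b ^ 2 + 1) / b)) * |β'|) * (t : ℝ))) * (∑ e : Edge 3 L, w e * (fundamentalLatticeRep 2).riemannDist (Q e) (Q' e) ^ 2) := hlub.2 hub
  have hprob : IsProbabilityMeasure π := by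
    constructor
    have h1 : π.map Prod.fst Set.univ = 1 := by rw [hπ.map_fst]; exact measure_univ
    rwa [Measure.map_apply measurable_fst MeasurableSet.univ, Set.preimage_univ] at h1
  haveI := hprob
  have hπ' : Literature.Geometry.Riemannian.IsCoupling (κ t Q) (κ t Q') π := ⟨hprob, hπ.map_fst, hπ.map_snd⟩
  have hρi : Integrable (fun z : GaugeConfig 3 L (Matrix.specialUnitaryGroup (Fin 2) ℂ) × GaugeConfig 3 L (Matrix.specialUnitaryGroup (Fin 2) ℂ) => (∑ e : Edge 3 L, w e * (fundamentalLatticeRep 2).riemannDist (z.1 e) (z.2 e) ^ 2)) π :=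
    hcont2.integrable_of_hasCompactSupport (HasCompactSupport.of_compactSpace _)
  calc szzWassersteinSq (fun U U' : GaugeConfig 3 L (Matrix.specialUnitaryGroup (Fin 2) ℂ) => (∑ e : Edge 3 L, w e * (fundamentalLatticeRep 2).riemannDist (U e) (U' e) ^ 2)) (κ t Q) (κ t Q')
      ≤ ∫⁻ z, ENNReal.ofReal ((∑ e : Edge 3 L, w e * (fundamentalLatticeRep 2).riemannDist (z.1 e) (z.2 e) ^ 2)) ∂π := szzWassersteinSq_le _ hπ'
    _ = ENNReal.ofReal (∫ z, (∑ e : Edge 3 L, w e * (fundamentalLatticeRep 2).riemannDist (z.1 e) (z.2 e) ^ 2) ∂π) :=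
        (ofReal_integral_eq_lintegral_ofReal hρi (ae_of_all _ fun z => hnn z.1 z.2)).symm
    _ ≤ ENNReal.ofReal (Real.exp (-(2 * (1 - (4 + 6 * ((b ^ 2 + 1) / b)) * |β'|) * (t : ℝ))) * (∑ e : Edge 3 L, w e * (fundamentalLatticeRep 2).riemannDist (Q e) (Q' e) ^ 2)) := ENNReal.ofReal_le_ofReal hcost

/-! ## §4. The Literature's conclusion shape -/

/-- ★★★★ **The weighted `W₂` Dirac contraction in the Literature's conclusion shape.**  For every `L`, `b ≥ 1`, `|β'| < 1/12` and every link weight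
`0 < m ≤ w ≤ M` with `w_e ≤ b²·w_(e')` on common plaquettes:  `SZZDiracContraction (fundamentalLatticeRep 2) 3 L β' (1 − (4+6(b²+1)/b)|β'|) d_w²` — for ANY
two strong solutions of the `SU(2)` lattice Langevin SDE started at `Q`, `Q̄` and every `t ≥ 0`, the coupling infimum of `E d_w(U_t,U'_t)²` is at most
`e^(−2κ_b t)·d_w(Q,Q̄)²` (`t = 0`: the Dirac coupling).  With `b = √a` and the torus weights `w_e = Σ_(lifts) a^(−|ẽ|)` this is the finite-volume form of
Shen–Zhu–Zhu's weighted coupling (metric `ρ_(∞,a)`), whose rate `1 − (4 + 6(a+1)/√a)|β'|` beats the printed `K̃_𝒮 = 1 − 8(1+√a)|β'|` for `a ≥ 1`.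
[cite: ShenZhuZhuCMP2023, Lemma 5.1 / (5.13)] [cite: BakryGentilLedoux2014, Thm 9.7.2] -/
theorem szzDiracContraction_wW2_su2 (L : ℕ) [NeZero L] (β' b : ℝ) (hb : 1 ≤ b) (hβ : |β'| < 1 / 12)
    (w : Edge 3 L → ℝ) {m M : ℝ} (hm : 0 < m) (hwm : ∀ e, m ≤ w e) (hwM : ∀ e, w e ≤ M)
    (hwb : ∀ (p : Plaquette 3 L) (e e' : Edge 3 L), e ∈ ({(p.1, p.2.1.1), (p.1.shift p.2.1.1, p.2.1.2), (p.1.shift p.2.1.2, p.2.1.1), (p.1, p.2.1.2)} : Finset (Edge 3 L)) → e' ∈ ({(p.1, p.2.1.1), (p.1.shift p.2.1.1, p.2.1.2), (p.1.shift p.2.1.2, p.2.1.1), (p.1, p.2.1.2)} : Finset (Edge 3 L)) → w e ≤ b ^ 2 * w e') :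
    SZZDiracContraction (fundamentalLatticeRep 2) 3 L β' (1 - (4 + 6 * ((b ^ 2 + 1) / b)) * |β'|) (fun U U' : GaugeConfig 3 L (Matrix.specialUnitaryGroup (Fin 2) ℂ) => (∑ e : Edge 3 L, w e * (fundamentalLatticeRep 2).riemannDist (U e) (U' e) ^ 2)) := by
  intro Ω _ P _ W hW U Q hU0 hU Ω' _ P' _ W' hW' U' Q' hU'0 hU' t
  classical
  haveI := secondCountableTopology_su2
  haveI := borelSpace_config L
  have hexp : Real.exp (-2 * (1 - (4 + 6 * ((b ^ 2 + 1) / b)) * |β'|) * (t : ℝ)) = Real.exp (-(2 * (1 - (4 + 6 * ((b ^ 2 + 1) / b)) * |β'|) * (t : ℝ))) := by congr 1; ring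
  rw [hexp]
  rcases eq_or_lt_of_le (show (0 : ℝ) ≤ (t : ℝ) from t.2) with ht | ht
  · -- `t = 0`: both laws are Dirac masses, couple them diagonally
    have ht0 : t = 0 := by exact_mod_cast ht.symm
    subst ht0
    have hUQ : U 0 = fun _ => Q := funext hU0
    have hUQ' : U' 0 = fun _ => Q' := funext hU'0
    rw [hUQ, hUQ', Measure.map_const, Measure.map_const, measure_univ, measure_univ, one_smul, one_smul]
    have hcpl : Literature.Geometry.Riemannian.IsCoupling (Measure.dirac Q) (Measure.dirac Q')
        (Measure.dirac (Q, Q') : Measure (GaugeConfig 3 L (Matrix.specialUnitaryGroup (Fin 2) ℂ) × GaugeConfig 3 L (Matrix.specialUnitaryGroup (Fin 2) ℂ))) := by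
      refine ⟨inferInstance, ?_, ?_⟩
      · rw [Measure.fst, Measure.map_dirac' measurable_fst]
      · rw [Measure.snd, Measure.map_dirac' measurable_snd]
    have hmeas : Measurable fun z : GaugeConfig 3 L (Matrix.specialUnitaryGroup (Fin 2) ℂ) × GaugeConfig 3 L (Matrix.specialUnitaryGroup (Fin 2) ℂ) => ENNReal.ofReal ((∑ e : Edge 3 L, w e * (fundamentalLatticeRep 2).riemannDist (z.1 e) (z.2 e) ^ 2)) :=
      ENNReal.measurable_ofReal.comp (continuous_wdistSq w).measurable
    calc szzWassersteinSq (fun U U' : GaugeConfig 3 L (Matrix.specialUnitaryGroup (Fin 2) ℂ) => (∑ e : Edge 3 L, w e * (fundamentalLatticeRep 2).riemannDist (U e) (U' e) ^ 2)) (Measure.dirac Q) (Measure.dirac Q')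
        ≤ ∫⁻ z, ENNReal.ofReal ((∑ e : Edge 3 L, w e * (fundamentalLatticeRep 2).riemannDist (z.1 e) (z.2 e) ^ 2)) ∂(Measure.dirac (Q, Q')) := szzWassersteinSq_le _ hcpl
      _ = ENNReal.ofReal ((∑ e : Edge 3 L, w e * (fundamentalLatticeRep 2).riemannDist (Q e) (Q' e) ^ 2)) := lintegral_dirac' _ hmeas
      _ = ENNReal.ofReal (Real.exp (-(2 * (1 - (4 + 6 * ((b ^ 2 + 1) / b)) * |β'|) * ((0 : ℝ≥0) : ℝ))) * (∑ e : Edge 3 L, w e * (fundamentalLatticeRep 2).riemannDist (Q e) (Q' e) ^ 2)) := by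
          rw [NNReal.coe_zero, mul_zero, neg_zero, Real.exp_zero, one_mul]
  · obtain ⟨κ, hκ, -, hreal⟩ := exists_transitionKernel L β'
    haveI := hκ
    rw [← hreal t Q Ω P W hW U hU0 hU, ← hreal t Q' Ω' P' W' hW' U' hU'0 hU']
    exact wilson_szzWasserstein_wW2_contraction L Q Q' β' b hb hβ w hm hwm hwM hwb κ hreal ht

end Summit.QuantumFields.YangMills.Theorems.ColdStartUniversality
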